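import Literature.MathematicalPhysics.QuantumFieldTheory.Balaban1983to89.T4CouplingMatching
import HarnessLib

/-!
# NE7MarginalL1Currency — route ℓ¹ of the NE7 crux («ℓ¹ CURRENCY FOR THE MARGINAL CHANNEL», `t4/ROUTES-NE7.md` §L2.1, rank 1 → t4-ne7-p1;
# cell C-L1°): node U6's `Summable δ` from TAIL- or SMEAR-DOMINATED injections; the ℓ¹ threshold is EXACT; the currency SURVIVES FADING MEMORY

Cell `pub-balaban`, rung (B)+1 sub-cell t4, lineage `b2b-balaban-t4-ne7-p1`, generation 28 (CRUX PROVER NE7 #1, ruling e34b3e0c item (2):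
the ASSIGNED seat files its ranked route; crux skeleton `t4/skeletons/NE7-CRUX-R1.md` v1.7.9 §1 ∕ §2 stub S1 (γ2) MARGINAL).  HONEST FRAMING
(page 1): FIXED FINITE T⁴, rung (B)+1; NE7 (node U5 «MATCHING MOD CONSTANTS») is NOT PRINTED in [Balaban1984PropagatorsI]–[Balaban1989LargeFieldII]
and NOT PROVED here; continuum YM on T⁴ ⇐ BetaPertH ∧ nine spine estimates (0/9 proved); BetaPertH ⇐ (D1) ∧ (D4) ∧ CAP+tail; G-an2-4 gates asym,
D1 and NE2/3/4; NOT infinite volume, NOT mass gap, NOT Clay.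

WHY.  Node U6 (`T4CauchySum.cauchySum`) consumes the transported totals `delta E ρ inj K = E·Σ_{j+n=K} inj K j·ρ^n` only through `Summable δ`;
the tree types the marginal injection (node U2's coupling discrepancy `T4CouplingMatching.disc` of two IR-pinned runs) in the GEOMETRIC currency
`InjectedRate C c θ inj`.  Lens 2 (`t4/ideate/NE7/lens2-NE7Lens2Sketch.lean`; PRICING-NE7 v2 §9.5 KEEP-as-typing; ADOPTED by this lineage at
gen 21, filing deferred) observed the EXACT ℓ¹ threshold: an injection dominated by the truncated TAIL `Σ_{i∈[j,K)} σ_i` of ONE nonnegative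
sequence gives `Σ_K δ_K < ∞ ⟺ Σ_i σ_i < ∞` (on the equality case).  This module files that currency as Summits kernel and EXTENDS it: with
GENUINE FADING MEMORY of the coupling history (the tree's `FadingMemory C ω`, not only the sketch's Markov ∕ last-only feedback) the discrepancy
at scale `j` is no longer tail-dominated — old scales leak in with weight `ω^{j−l}` — but SMEAR-DOMINATED, `inj K j ≤ M·Σ_{l<K} σ_l·ω^{(j−l)₊}`,
and `Summable δ` STILL follows from `Σσ < ∞` alone (§3).

WHAT IS PROVED ([folklore] real analysis over the tree's U6 shapes; 0 sorry; nothing of Bałaban's asserted — `σ`, `inj` are abstract sequences):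
§1 SHAPES `TailDominated M σ inj`, `ShiftAlongRun σ β gB K` (sketch, verbatim), `smear ω σ K j := Σ_{l<K} σ_l ω^{j−l}` (ℕ-subtraction =
   positive part), `SmearDominated M ω σ inj`; `smear_zero_eq_tail` (ω = 0 is the tail), `tail_le_smear`, `TailDominated.smearDominated`.
§2 (A1, ported from the sketch with credit) `sum_geom_mul_tail_le` (exchange lemma), `delta_le_conv_of_tailDominated`
   (`δ_K ≤ E·M·(1−ρ)⁻¹·Σ_{i≤K} σ_i ρ^{K−i}`), `summable_conv_geometric` (Cauchy product), **`summable_delta_of_tailDominated`**; NEW: the ℓ¹ bound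
   **`tsum_delta_le_of_tailDominated`** `Σ_K δ_K ≤ E·M·(1−ρ)⁻²·Σ_i σ_i`.
§3 (A1′, NEW) `smearKernel ρ ω n = (1−ρ)⁻¹ρ^n + n·max(ρ,ω)^n` (summable), `inner_le_smearKernel` (`Σ_{j≤K} ρ^{K−j}ω^{(j−l)₊} ≤ smearKernel (K−l)`),
   `delta_le_conv_of_smearDominated`, `summable_conv`, **`summable_delta_of_smearDominated`** — the ℓ¹ currency survives fading memory.
§4 (EXACTNESS, NEW proof of the sketch's `ThresholdExactStatement`) `tailInj σ K j = Σ_{i∈[j,K)} σ_i` is `TailDominated 1 σ`;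
   `le_delta_tailInj` (`ρ·σ_K ≤ δ_{K+1}`); **`not_summable_delta_tailInj`**: `σ ≥ 0` not summable, `0 < ρ` ⇒ `delta 1 ρ (tailInj σ)` not summable
   (the tree's Gawȩdzki–Kupiainen witness `T4BetaMemory.harmonicDisc c` is the equality case `σ_i = c∕(i+1)`: «no rate» becomes «not even summable»).
The node-U6 drop-ins (`cauchySum_l1` ∕ `cauchySum_smear`) and the production of both shapes from two IR-pinned runs of (0.20) are in the
companions `NE7MarginalL1Runs` ∕ `NE7MarginalL1Assembly`.
HONEST: re-denominates the marginal channel's UNPRINTED input (WALL §3 (γ2)∕(γ3)) to its provably minimal currency for the δ-road and shows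
the currency robust to memory; removes no input by name; NE7 NOT proved; NOT summit progress.
-/

noncomputable section

open Finset

namespace Summit.QuantumFields.BalabanUV.T4Continuum.NE7MarginalL1Currency

open Literature.MathematicalPhysics.QuantumFieldTheory.Balaban1983to89
open T4CauchySum (delta)

/-! ## §1 The two ℓ¹ shapes: tail-dominated (Markov feedback) and smear-dominated (fading memory) injections -/

/-- HYPOTHESIS SHAPE (replaces `T4CauchySum.InjectedRate C c θ inj` for the MARGINAL component; lens-2 sketch, verbatim): the discrepancy
injected at scale `j ≤ K` is dominated by the TRUNCATED TAIL of one fixed nonnegative shift sequence `σ`,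
`0 ≤ inj K j ≤ M·Σ_{i∈[j,K)} σ_i` — the shape `T4CouplingMatching.backward_sum` ∕ `disc_le_of_lastOnly` produce. [folklore] -/
@[folklore]
def TailDominated (M : ℝ) (σ : ℕ → ℝ) (inj : ℕ → ℕ → ℝ) : Prop :=
  ∀ K j : ℕ, j ≤ K → 0 ≤ inj K j ∧ inj K j ≤ M * ∑ i ∈ Ico j K, σ i

/-- The ω-SMEARED tail of `σ` below `K`, read at scale `j`: `smear ω σ K j = Σ_{l<K} σ_l·ω^{j−l}` with ℕ-subtraction, i.e. weight `1` on the
scales `l ≥ j` not older than `j` (the tail) and weight `ω^{j−l}` on the OLDER scales `l < j` (the leak of old discrepancies through a memory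
fading at rate `ω`). [folklore] -/
def smear (ω : ℝ) (σ : ℕ → ℝ) (K j : ℕ) : ℝ := ∑ l ∈ range K, σ l * ω ^ (j - l)

/-- HYPOTHESIS SHAPE (fading-memory feedback): `0 ≤ inj K j ≤ M·smear ω σ K j` for `j ≤ K`.  At `ω = 0` this is `TailDominated`
(`smearDominated_zero_iff`); the companion `NE7MarginalL1Runs.smearDominated_of_runs_fadingMemory` produces it with `M = 2`. [folklore] -/
@[folklore]
def SmearDominated (M ω : ℝ) (σ : ℕ → ℝ) (inj : ℕ → ℕ → ℝ) : Prop :=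
  ∀ K j : ℕ, j ≤ K → 0 ≤ inj K j ∧ inj K j ≤ M * smear ω σ K j

/-- HYPOTHESIS SHAPE (the supplier side, lens-2 sketch verbatim): the β-shift between depth `j+1` and depth `j`, evaluated ON RUN B's ACTUAL
HISTORY `(g^B_0,…,g^B_{j+1})` — not as a sup over the box — is at most `σ j` for `j < K` (`σ` K-independent: the supplier's bound must be
K-UNIFORM, PRICING-NE7 v2 §9.5 (b)).  Replaces `T4CouplingMatching.ScaleShiftRate c θ γ β`'s `c·θ^j`; consumed by `NE7MarginalL1Runs`. [folklore] -/
@[folklore]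
def ShiftAlongRun (σ : ℕ → ℝ) (β : FlowStep.HBeta) (gB : ℕ → ℝ) (K : ℕ) : Prop :=
  ∀ j, j < K → |β (j + 1) (FlowStep.prefixOf gB (j + 1)) - β j (Fin.tail (FlowStep.prefixOf gB (j + 1)))| ≤ σ j

/-- `smear` is nonnegative for `σ ≥ 0`, `ω ≥ 0`. [folklore] -/
theorem smear_nonneg {ω : ℝ} {σ : ℕ → ℝ} (hω : 0 ≤ ω) (hσ : ∀ i, 0 ≤ σ i) (K j : ℕ) : 0 ≤ smear ω σ K j :=
  Finset.sum_nonneg fun l _ => mul_nonneg (hσ l) (pow_nonneg hω _)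

/-- At `ω = 0` the smear IS the truncated tail: `smear 0 σ K j = Σ_{i∈[j,K)} σ_i` (`j ≤ K`). [folklore] -/
theorem smear_zero_eq_tail (σ : ℕ → ℝ) {K j : ℕ} (hj : j ≤ K) : smear 0 σ K j = ∑ i ∈ Ico j K, σ i := by
  unfold smear
  rw [← Finset.sum_range_add_sum_Ico _ hj]
  have h1 : ∑ l ∈ range j, σ l * (0 : ℝ) ^ (j - l) = 0 := Finset.sum_eq_zero fun l hl => by
    have : j - l ≠ 0 := by have := mem_range.mp hl; omega
    simp [zero_pow this]
  have h2 : ∑ l ∈ Ico j K, σ l * (0 : ℝ) ^ (j - l) = ∑ l ∈ Ico j K, σ l := Finset.sum_congr rfl fun l hl => by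
    have : j - l = 0 := by have := (mem_Ico.mp hl).1; omega
    simp [this]
  rw [h1, h2, zero_add]

/-- The tail is below every smear with `ω ≥ 0` (`σ ≥ 0`). [folklore] -/
theorem tail_le_smear {ω : ℝ} {σ : ℕ → ℝ} (hω : 0 ≤ ω) (hσ : ∀ i, 0 ≤ σ i) {K j : ℕ} :
    ∑ i ∈ Ico j K, σ i ≤ smear ω σ K j := by
  unfold smear
  calc ∑ i ∈ Ico j K, σ i = ∑ i ∈ Ico j K, σ i * ω ^ (j - i) := Finset.sum_congr rfl fun i hi => by
        have : j - i = 0 := by have := (mem_Ico.mp hi).1; omega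
        simp [this]
    _ ≤ ∑ l ∈ range K, σ l * ω ^ (j - l) := by
        refine Finset.sum_le_sum_of_subset_of_nonneg (fun i hi => ?_) fun l _ _ => mul_nonneg (hσ l) (pow_nonneg hω _)
        exact mem_range.mpr (mem_Ico.mp hi).2

/-- `SmearDominated M 0 σ inj ↔ TailDominated M σ inj`. [folklore] -/
theorem smearDominated_zero_iff {M : ℝ} {σ : ℕ → ℝ} {inj : ℕ → ℕ → ℝ} :
    SmearDominated M 0 σ inj ↔ TailDominated M σ inj := by
  constructor
  · intro h K j hj
    have := h K j hj
    rwa [smear_zero_eq_tail σ hj] at this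
  · intro h K j hj
    have := h K j hj
    rwa [← smear_zero_eq_tail σ hj] at this

/-- A tail-dominated injection is smear-dominated for every memory rate `ω ≥ 0` (`M, σ ≥ 0`). [folklore] -/
theorem TailDominated.smearDominated {M ω : ℝ} {σ : ℕ → ℝ} {inj : ℕ → ℕ → ℝ} (h : TailDominated M σ inj) (hM : 0 ≤ M)
    (hω : 0 ≤ ω) (hσ : ∀ i, 0 ≤ σ i) : SmearDominated M ω σ inj := fun K j hj =>
  ⟨(h K j hj).1, (h K j hj).2.trans (mul_le_mul_of_nonneg_left (tail_le_smear hω hσ) hM)⟩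

/-! ## §2 (A1) ℓ¹ shifts suffice: `Summable (delta E ρ inj)` from a tail-dominated injection — the sketch, ported -/

/-- Partial geometric sums are bounded by `(1 − ρ)⁻¹`. [folklore] -/
theorem geom_partial_le {ρ : ℝ} (hρ0 : 0 ≤ ρ) (hρ1 : ρ < 1) (s : Finset ℕ) : ∑ m ∈ s, ρ ^ m ≤ (1 - ρ)⁻¹ :=
  sum_le_hasSum s (fun m _ => pow_nonneg hρ0 m) (hasSum_geometric_of_lt_one hρ0 hρ1)

/-- THE EXCHANGE LEMMA (lens-2 sketch): `Σ_{j≤K} ρ^{K−j}·Σ_{i∈[j,K)} σ_i ≤ (1−ρ)⁻¹·Σ_{i≤K} σ_i ρ^{K−i}` (Fubini over `j ≤ i < K`, then the partial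
geometric sum in `j`). [folklore] -/
theorem sum_geom_mul_tail_le (σ : ℕ → ℝ) (hσ : ∀ i, 0 ≤ σ i) {ρ : ℝ} (hρ0 : 0 ≤ ρ) (hρ1 : ρ < 1) (K : ℕ) :
    ∑ j ∈ range (K + 1), ρ ^ (K - j) * ∑ i ∈ Ico j K, σ i ≤ (1 - ρ)⁻¹ * ∑ i ∈ range (K + 1), σ i * ρ ^ (K - i) := by
  have hex : ∑ j ∈ range (K + 1), ρ ^ (K - j) * ∑ i ∈ Ico j K, σ i
      = ∑ i ∈ range K, ∑ j ∈ range (i + 1), ρ ^ (K - j) * σ i := by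
    simp_rw [Finset.mul_sum]
    refine Finset.sum_comm' ?_
    intro j i
    simp only [mem_range, mem_Ico]
    omega
  rw [hex, Finset.mul_sum]
  have hK : ∑ i ∈ range K, ∑ j ∈ range (i + 1), ρ ^ (K - j) * σ i ≤ ∑ i ∈ range K, (1 - ρ)⁻¹ * (σ i * ρ ^ (K - i)) := by
    refine Finset.sum_le_sum fun i hi => ?_
    have hiK : i < K := mem_range.mp hi
    have hgeom : ∑ j ∈ range (i + 1), ρ ^ (K - j) = ρ ^ (K - i) * ∑ j ∈ range (i + 1), ρ ^ (i - j) := by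
      rw [Finset.mul_sum]
      refine Finset.sum_congr rfl fun j hj => ?_
      have hji : j ≤ i := Nat.lt_succ_iff.mp (mem_range.mp hj)
      rw [← pow_add]
      congr 1
      omega
    have hrefl : ∑ j ∈ range (i + 1), ρ ^ (i - j) = ∑ m ∈ range (i + 1), ρ ^ m := by
      have := Finset.sum_range_reflect (fun m => ρ ^ m) (i + 1)
      simpa using this
    calc ∑ j ∈ range (i + 1), ρ ^ (K - j) * σ i = (∑ j ∈ range (i + 1), ρ ^ (K - j)) * σ i := by rw [Finset.sum_mul]
      _ = ρ ^ (K - i) * (∑ m ∈ range (i + 1), ρ ^ m) * σ i := by rw [hgeom, hrefl]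
      _ ≤ ρ ^ (K - i) * (1 - ρ)⁻¹ * σ i := by
          have h1 := geom_partial_le hρ0 hρ1 (range (i + 1))
          have h2 : 0 ≤ ρ ^ (K - i) := pow_nonneg hρ0 _
          nlinarith [hσ i, mul_le_mul_of_nonneg_left h1 h2]
      _ = (1 - ρ)⁻¹ * (σ i * ρ ^ (K - i)) := by ring
  refine hK.trans ?_
  rw [← Finset.mul_sum, ← Finset.mul_sum]
  have hρ' : 0 ≤ (1 - ρ)⁻¹ := inv_nonneg.mpr (by linarith)
  refine mul_le_mul_of_nonneg_left ?_ hρ'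
  rw [Finset.sum_range_succ]
  have : 0 ≤ σ K * ρ ^ (K - K) := mul_nonneg (hσ K) (pow_nonneg hρ0 _)
  linarith

/-- `delta` of a tail-dominated injection is bounded by the geometric CONVOLUTION of the shift sequence:
`delta E ρ inj K ≤ E·M·(1−ρ)⁻¹·Σ_{i≤K} σ_i ρ^{K−i}` (lens-2 sketch). [folklore] -/
theorem delta_le_conv_of_tailDominated {E M ρ : ℝ} {σ : ℕ → ℝ} {inj : ℕ → ℕ → ℝ} (h : TailDominated M σ inj) (hE : 0 ≤ E)
    (hM : 0 ≤ M) (hσ : ∀ i, 0 ≤ σ i) (hρ0 : 0 ≤ ρ) (hρ1 : ρ < 1) (K : ℕ) :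
    delta E ρ inj K ≤ E * M * (1 - ρ)⁻¹ * ∑ i ∈ range (K + 1), σ i * ρ ^ (K - i) := by
  unfold delta
  rw [Finset.Nat.sum_antidiagonal_eq_sum_range_succ (fun j n => inj K j * ρ ^ n) K]
  have h1 : ∑ j ∈ range (K + 1), inj K j * ρ ^ (K - j) ≤ M * ∑ j ∈ range (K + 1), ρ ^ (K - j) * ∑ i ∈ Ico j K, σ i := by
    rw [Finset.mul_sum]
    refine Finset.sum_le_sum fun j hj => ?_
    have hjK : j ≤ K := Nat.lt_succ_iff.mp (mem_range.mp hj)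
    calc inj K j * ρ ^ (K - j) ≤ (M * ∑ i ∈ Ico j K, σ i) * ρ ^ (K - j) :=
          mul_le_mul_of_nonneg_right (h K j hjK).2 (pow_nonneg hρ0 _)
      _ = M * (ρ ^ (K - j) * ∑ i ∈ Ico j K, σ i) := by ring
  have h2 := sum_geom_mul_tail_le σ hσ hρ0 hρ1 K
  calc E * ∑ j ∈ range (K + 1), inj K j * ρ ^ (K - j) ≤ E * (M * ∑ j ∈ range (K + 1), ρ ^ (K - j) * ∑ i ∈ Ico j K, σ i) :=
        mul_le_mul_of_nonneg_left h1 hE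
    _ ≤ E * (M * ((1 - ρ)⁻¹ * ∑ i ∈ range (K + 1), σ i * ρ ^ (K - i))) :=
        mul_le_mul_of_nonneg_left (mul_le_mul_of_nonneg_left h2 hM) hE
    _ = E * M * (1 - ρ)⁻¹ * ∑ i ∈ range (K + 1), σ i * ρ ^ (K - i) := by ring

/-- The geometric convolution of an ℓ¹ sequence is ℓ¹ (Cauchy product). [folklore] -/
theorem summable_conv_geometric {σ : ℕ → ℝ} (hs : Summable σ) (hσ : ∀ i, 0 ≤ σ i) {ρ : ℝ} (hρ0 : 0 ≤ ρ) (hρ1 : ρ < 1) :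
    Summable (fun K => ∑ i ∈ range (K + 1), σ i * ρ ^ (K - i)) := by
  have hσn : Summable (fun i => ‖σ i‖) := by simpa [Real.norm_eq_abs, abs_of_nonneg (hσ _)] using hs
  have hgn : Summable (fun n => ‖ρ ^ n‖) := by
    simpa [norm_pow, Real.norm_eq_abs, abs_of_nonneg hρ0] using summable_geometric_of_lt_one hρ0 hρ1
  have hprod := summable_mul_of_summable_norm hσn hgn
  have hcauchy := summable_sum_mul_antidiagonal_of_summable_mul hprod
  refine hcauchy.congr fun K => ?_
  exact Finset.Nat.sum_antidiagonal_eq_sum_range_succ (fun i n => σ i * ρ ^ n) K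

/-- `delta` of a tail-dominated injection is nonnegative (`E ≥ 0`, `ρ ≥ 0`). [folklore] -/
theorem delta_nonneg_of_tailDominated {E M ρ : ℝ} {σ : ℕ → ℝ} {inj : ℕ → ℕ → ℝ} (h : TailDominated M σ inj) (hE : 0 ≤ E)
    (hρ0 : 0 ≤ ρ) (K : ℕ) : 0 ≤ delta E ρ inj K :=
  mul_nonneg hE (Finset.sum_nonneg fun p hp =>
    mul_nonneg (h K p.1 (by have := mem_antidiagonal.mp hp; omega)).1 (pow_nonneg hρ0 _))

/-- **(A1) ℓ¹ SHIFTS SUFFICE.**  A tail-dominated injection with `Σ σ < ∞` has summable transported totals, for every contraction `ρ ∈ [0,1[` —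
no rate `θ` anywhere (lens-2 sketch). [folklore] -/
theorem summable_delta_of_tailDominated {E M ρ : ℝ} {σ : ℕ → ℝ} {inj : ℕ → ℕ → ℝ} (h : TailDominated M σ inj) (hE : 0 ≤ E)
    (hM : 0 ≤ M) (hσ : ∀ i, 0 ≤ σ i) (hs : Summable σ) (hρ0 : 0 ≤ ρ) (hρ1 : ρ < 1) : Summable (delta E ρ inj) :=
  Summable.of_nonneg_of_le (fun K => delta_nonneg_of_tailDominated h hE hρ0 K)
    (fun K => delta_le_conv_of_tailDominated h hE hM hσ hρ0 hρ1 K) ((summable_conv_geometric hs hσ hρ0 hρ1).mul_left _)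

/-- **THE ℓ¹ BOUND** (NEW): `Σ_K delta E ρ inj K ≤ E·M·(1−ρ)⁻²·Σ_i σ_i` — the Cauchy product summed (`Σ_K Σ_{i≤K} σ_iρ^{K−i} = (Σσ)(Σρ^n)`).
[folklore] -/
theorem tsum_delta_le_of_tailDominated {E M ρ : ℝ} {σ : ℕ → ℝ} {inj : ℕ → ℕ → ℝ} (h : TailDominated M σ inj) (hE : 0 ≤ E)
    (hM : 0 ≤ M) (hσ : ∀ i, 0 ≤ σ i) (hs : Summable σ) (hρ0 : 0 ≤ ρ) (hρ1 : ρ < 1) :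
    ∑' K, delta E ρ inj K ≤ E * M * (1 - ρ)⁻¹ ^ 2 * ∑' i, σ i := by
  have hconv := summable_conv_geometric hs hσ hρ0 hρ1
  have h1 : ∑' K, delta E ρ inj K ≤ ∑' K, E * M * (1 - ρ)⁻¹ * ∑ i ∈ range (K + 1), σ i * ρ ^ (K - i) :=
    (summable_delta_of_tailDominated h hE hM hσ hs hρ0 hρ1).tsum_le_tsum
      (fun K => delta_le_conv_of_tailDominated h hE hM hσ hρ0 hρ1 K) (hconv.mul_left _)
  have hσn : Summable (fun i => ‖σ i‖) := by simpa [Real.norm_eq_abs, abs_of_nonneg (hσ _)] using hs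
  have hgn : Summable (fun n => ‖ρ ^ n‖) := by
    simpa [norm_pow, Real.norm_eq_abs, abs_of_nonneg hρ0] using summable_geometric_of_lt_one hρ0 hρ1
  have hcp : ∑' K, ∑ i ∈ range (K + 1), σ i * ρ ^ (K - i) = (∑' i, σ i) * ∑' n, ρ ^ n :=
    (tsum_mul_tsum_eq_tsum_sum_range_of_summable_norm hσn hgn).symm
  rw [tsum_mul_left, hcp, tsum_geometric_of_lt_one hρ0 hρ1] at h1
  calc ∑' K, delta E ρ inj K ≤ E * M * (1 - ρ)⁻¹ * ((∑' i, σ i) * (1 - ρ)⁻¹) := h1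
    _ = E * M * (1 - ρ)⁻¹ ^ 2 * ∑' i, σ i := by ring

/-! ## §3 (A1′, NEW) The currency survives fading memory: `Summable (delta E ρ inj)` from a SMEAR-dominated injection -/

/-- The transport-times-leak kernel: `smearKernel ρ ω n = (1−ρ)⁻¹·ρ^n + n·max(ρ,ω)^n`. [folklore] -/
def smearKernel (ρ ω : ℝ) (n : ℕ) : ℝ := (1 - ρ)⁻¹ * ρ ^ n + (n : ℝ) * (max ρ ω) ^ n

/-- `0 ≤ smearKernel ρ ω n` for `0 ≤ ρ < 1` (any `ω`: `max ρ ω ≥ 0`). [folklore] -/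
theorem smearKernel_nonneg {ρ : ℝ} (ω : ℝ) (hρ0 : 0 ≤ ρ) (hρ1 : ρ < 1) (n : ℕ) : 0 ≤ smearKernel ρ ω n := by
  unfold smearKernel
  have : 0 ≤ (1 - ρ)⁻¹ := inv_nonneg.mpr (by linarith)
  have hq : 0 ≤ max ρ ω := hρ0.trans (le_max_left _ _)
  positivity

/-- The kernel is summable for `0 ≤ ρ < 1`, `ω < 1`. [folklore] -/
theorem summable_smearKernel {ρ ω : ℝ} (hρ0 : 0 ≤ ρ) (hρ1 : ρ < 1) (hω1 : ω < 1) : Summable (smearKernel ρ ω) := by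
  have hq0 : 0 ≤ max ρ ω := hρ0.trans (le_max_left _ _)
  have hq1 : max ρ ω < 1 := max_lt hρ1 hω1
  have h1 : Summable (fun n : ℕ => (1 - ρ)⁻¹ * ρ ^ n) := (summable_geometric_of_lt_one hρ0 hρ1).mul_left _
  have h2 : Summable (fun n : ℕ => (n : ℝ) * (max ρ ω) ^ n) := by
    have := summable_pow_mul_geometric_of_norm_lt_one 1 (by rwa [Real.norm_eq_abs, abs_of_nonneg hq0] : ‖max ρ ω‖ < 1)
    simpa [pow_one] using this
  exact h1.add h2

/-- THE INNER BOUND: for `l ≤ K`, `Σ_{j≤K} ρ^{K−j}·ω^{(j−l)₊} ≤ smearKernel ρ ω (K−l)` — the scales `j ≤ l` give the transported geometric sum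
`ρ^{K−l}(1−ρ)⁻¹`, the `K − l` scales `l < j ≤ K` give at most `max(ρ,ω)^{K−l}` each. [folklore] -/
theorem inner_le_smearKernel {ρ ω : ℝ} (hρ0 : 0 ≤ ρ) (hρ1 : ρ < 1) (hω0 : 0 ≤ ω) {K l : ℕ} (hl : l ≤ K) :
    ∑ j ∈ range (K + 1), ρ ^ (K - j) * ω ^ (j - l) ≤ smearKernel ρ ω (K - l) := by
  have hq0 : 0 ≤ max ρ ω := hρ0.trans (le_max_left _ _)
  rw [← Finset.sum_range_add_sum_Ico _ (Nat.succ_le_succ hl)]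
  -- scales j ≤ l: the leak weight is 1, the transport sums geometrically
  have hA : ∑ j ∈ range (l + 1), ρ ^ (K - j) * ω ^ (j - l) ≤ (1 - ρ)⁻¹ * ρ ^ (K - l) := by
    have e : ∑ j ∈ range (l + 1), ρ ^ (K - j) * ω ^ (j - l) = ρ ^ (K - l) * ∑ j ∈ range (l + 1), ρ ^ (l - j) := by
      rw [Finset.mul_sum]
      refine Finset.sum_congr rfl fun j hj => ?_
      have hjl : j ≤ l := Nat.lt_succ_iff.mp (mem_range.mp hj)
      have h0 : j - l = 0 := by omega
      rw [h0, pow_zero, mul_one, ← pow_add]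
      congr 1
      omega
    have hrefl : ∑ j ∈ range (l + 1), ρ ^ (l - j) = ∑ m ∈ range (l + 1), ρ ^ m := by
      have := Finset.sum_range_reflect (fun m => ρ ^ m) (l + 1)
      simpa using this
    rw [e, hrefl]
    have h1 := geom_partial_le hρ0 hρ1 (range (l + 1))
    have h2 : 0 ≤ ρ ^ (K - l) := pow_nonneg hρ0 _
    calc ρ ^ (K - l) * ∑ m ∈ range (l + 1), ρ ^ m ≤ ρ ^ (K - l) * (1 - ρ)⁻¹ := mul_le_mul_of_nonneg_left h1 h2
      _ = (1 - ρ)⁻¹ * ρ ^ (K - l) := by ring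
  -- scales l < j ≤ K: each term ≤ max(ρ,ω)^{K−l}, and there are K − l of them
  have hB : ∑ j ∈ Ico (l + 1) (K + 1), ρ ^ (K - j) * ω ^ (j - l) ≤ ((K - l : ℕ) : ℝ) * (max ρ ω) ^ (K - l) := by
    have hterm : ∀ j ∈ Ico (l + 1) (K + 1), ρ ^ (K - j) * ω ^ (j - l) ≤ (max ρ ω) ^ (K - l) := by
      intro j hj
      have hj' := mem_Ico.mp hj
      calc ρ ^ (K - j) * ω ^ (j - l) ≤ (max ρ ω) ^ (K - j) * (max ρ ω) ^ (j - l) :=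
            mul_le_mul (pow_le_pow_left₀ hρ0 (le_max_left _ _) _) (pow_le_pow_left₀ hω0 (le_max_right _ _) _)
              (pow_nonneg hω0 _) (pow_nonneg hq0 _)
        _ = (max ρ ω) ^ (K - l) := by
            rw [← pow_add]
            congr 1
            omega
    calc ∑ j ∈ Ico (l + 1) (K + 1), ρ ^ (K - j) * ω ^ (j - l) ≤ ∑ j ∈ Ico (l + 1) (K + 1), (max ρ ω) ^ (K - l) :=
          Finset.sum_le_sum hterm
      _ = ((K - l : ℕ) : ℝ) * (max ρ ω) ^ (K - l) := by
          rw [Finset.sum_const, Nat.card_Ico, nsmul_eq_mul]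
          congr 2
          omega
  unfold smearKernel
  linarith

/-- Exchange of the smear against the transport: `Σ_{j≤K} smear ω σ K j·ρ^{K−j} = Σ_{l<K} σ_l·Σ_{j≤K} ρ^{K−j}ω^{(j−l)₊}`. [folklore] -/
theorem sum_smear_mul_geom (ω ρ : ℝ) (σ : ℕ → ℝ) (K : ℕ) :
    ∑ j ∈ range (K + 1), smear ω σ K j * ρ ^ (K - j) = ∑ l ∈ range K, σ l * ∑ j ∈ range (K + 1), ρ ^ (K - j) * ω ^ (j - l) := by
  unfold smear
  simp_rw [Finset.sum_mul, Finset.mul_sum]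
  rw [Finset.sum_comm]
  refine Finset.sum_congr rfl fun l _ => Finset.sum_congr rfl fun j _ => ?_
  ring

/-- `delta` of a smear-dominated injection is bounded by the convolution of `σ` with the smear kernel:
`delta E ρ inj K ≤ E·M·Σ_{l≤K} σ_l·smearKernel ρ ω (K−l)`. [folklore] -/
theorem delta_le_conv_of_smearDominated {E M ρ ω : ℝ} {σ : ℕ → ℝ} {inj : ℕ → ℕ → ℝ} (h : SmearDominated M ω σ inj) (hE : 0 ≤ E)
    (hM : 0 ≤ M) (hσ : ∀ i, 0 ≤ σ i) (hρ0 : 0 ≤ ρ) (hρ1 : ρ < 1) (hω0 : 0 ≤ ω) (K : ℕ) :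
    delta E ρ inj K ≤ E * M * ∑ l ∈ range (K + 1), σ l * smearKernel ρ ω (K - l) := by
  unfold delta
  rw [Finset.Nat.sum_antidiagonal_eq_sum_range_succ (fun j n => inj K j * ρ ^ n) K]
  have h1 : ∑ j ∈ range (K + 1), inj K j * ρ ^ (K - j) ≤ M * ∑ j ∈ range (K + 1), smear ω σ K j * ρ ^ (K - j) := by
    rw [Finset.mul_sum]
    refine Finset.sum_le_sum fun j hj => ?_
    have hjK : j ≤ K := Nat.lt_succ_iff.mp (mem_range.mp hj)
    calc inj K j * ρ ^ (K - j) ≤ (M * smear ω σ K j) * ρ ^ (K - j) := mul_le_mul_of_nonneg_right (h K j hjK).2 (pow_nonneg hρ0 _)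
      _ = M * (smear ω σ K j * ρ ^ (K - j)) := by ring
  have h2 : ∑ j ∈ range (K + 1), smear ω σ K j * ρ ^ (K - j) ≤ ∑ l ∈ range (K + 1), σ l * smearKernel ρ ω (K - l) := by
    rw [sum_smear_mul_geom]
    calc ∑ l ∈ range K, σ l * ∑ j ∈ range (K + 1), ρ ^ (K - j) * ω ^ (j - l)
        ≤ ∑ l ∈ range K, σ l * smearKernel ρ ω (K - l) :=
          Finset.sum_le_sum fun l hl => mul_le_mul_of_nonneg_left (inner_le_smearKernel hρ0 hρ1 hω0 (mem_range.mp hl).le) (hσ l)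
      _ ≤ ∑ l ∈ range (K + 1), σ l * smearKernel ρ ω (K - l) :=
          Finset.sum_le_sum_of_subset_of_nonneg (Finset.range_mono (Nat.le_succ K))
            fun l _ _ => mul_nonneg (hσ l) (smearKernel_nonneg ω hρ0 hρ1 _)
  calc E * ∑ j ∈ range (K + 1), inj K j * ρ ^ (K - j) ≤ E * (M * ∑ j ∈ range (K + 1), smear ω σ K j * ρ ^ (K - j)) :=
        mul_le_mul_of_nonneg_left h1 hE
    _ ≤ E * (M * ∑ l ∈ range (K + 1), σ l * smearKernel ρ ω (K - l)) := mul_le_mul_of_nonneg_left (mul_le_mul_of_nonneg_left h2 hM) hE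
    _ = E * M * ∑ l ∈ range (K + 1), σ l * smearKernel ρ ω (K - l) := by ring

/-- The convolution of two nonnegative ℓ¹ sequences is ℓ¹ (Cauchy product). [folklore] -/
theorem summable_conv {σ ψ : ℕ → ℝ} (hs : Summable σ) (hσ : ∀ i, 0 ≤ σ i) (hp : Summable ψ) (hψ : ∀ n, 0 ≤ ψ n) :
    Summable (fun K => ∑ l ∈ range (K + 1), σ l * ψ (K - l)) := by
  have hσn : Summable (fun i => ‖σ i‖) := by simpa [Real.norm_eq_abs, abs_of_nonneg (hσ _)] using hs
  have hψn : Summable (fun n => ‖ψ n‖) := by simpa [Real.norm_eq_abs, abs_of_nonneg (hψ _)] using hp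
  have hcauchy := summable_sum_mul_antidiagonal_of_summable_mul (summable_mul_of_summable_norm hσn hψn)
  refine hcauchy.congr fun K => ?_
  exact Finset.Nat.sum_antidiagonal_eq_sum_range_succ (fun i n => σ i * ψ n) K

/-- `delta` of a smear-dominated injection is nonnegative (`E ≥ 0`, `ρ ≥ 0`). [folklore] -/
theorem delta_nonneg_of_smearDominated {E M ρ ω : ℝ} {σ : ℕ → ℝ} {inj : ℕ → ℕ → ℝ} (h : SmearDominated M ω σ inj) (hE : 0 ≤ E)
    (hρ0 : 0 ≤ ρ) (K : ℕ) : 0 ≤ delta E ρ inj K :=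
  mul_nonneg hE (Finset.sum_nonneg fun p hp =>
    mul_nonneg (h K p.1 (by have := mem_antidiagonal.mp hp; omega)).1 (pow_nonneg hρ0 _))

/-- **(A1′) THE ℓ¹ CURRENCY SURVIVES FADING MEMORY.**  A smear-dominated injection (memory rate `ω ∈ [0,1[`) with `Σ σ < ∞` has summable
transported totals for every contraction `ρ ∈ [0,1[`. [folklore] -/
theorem summable_delta_of_smearDominated {E M ρ ω : ℝ} {σ : ℕ → ℝ} {inj : ℕ → ℕ → ℝ} (h : SmearDominated M ω σ inj) (hE : 0 ≤ E)
    (hM : 0 ≤ M) (hσ : ∀ i, 0 ≤ σ i) (hs : Summable σ) (hρ0 : 0 ≤ ρ) (hρ1 : ρ < 1) (hω0 : 0 ≤ ω) (hω1 : ω < 1) :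
    Summable (delta E ρ inj) :=
  Summable.of_nonneg_of_le (fun K => delta_nonneg_of_smearDominated h hE hρ0 K)
    (fun K => delta_le_conv_of_smearDominated h hE hM hσ hρ0 hρ1 hω0 K)
    ((summable_conv hs hσ (summable_smearKernel hρ0 hρ1 hω1) (smearKernel_nonneg ω hρ0 hρ1)).mul_left _)

/-! ## §4 (EXACTNESS, NEW) Nothing weaker than ℓ¹ passes the δ-road: the equality case -/

/-- The EQUALITY CASE of `TailDominated` with `M = 1`: the injection IS the truncated tail, `tailInj σ K j = Σ_{i∈[j,K)} σ_i`. [folklore] -/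
def tailInj (σ : ℕ → ℝ) : ℕ → ℕ → ℝ := fun K j => ∑ i ∈ Ico j K, σ i

/-- `tailInj σ` is tail-dominated with constant `1` (`σ ≥ 0`). [folklore] -/
theorem tailDominated_tailInj {σ : ℕ → ℝ} (hσ : ∀ i, 0 ≤ σ i) : TailDominated 1 σ (tailInj σ) := fun K j _ =>
  ⟨Finset.sum_nonneg fun i _ => hσ i, by unfold tailInj; rw [one_mul]⟩

/-- ONE TERM OF THE ANTIDIAGONAL: `ρ·σ_K ≤ delta 1 ρ (tailInj σ) (K+1)` (the scale `j = K` of the run with `K+1` steps carries the single shift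
`σ_K`, transported once). [folklore] -/
theorem le_delta_tailInj {σ : ℕ → ℝ} (hσ : ∀ i, 0 ≤ σ i) {ρ : ℝ} (hρ : 0 ≤ ρ) (K : ℕ) :
    ρ * σ K ≤ delta 1 ρ (tailInj σ) (K + 1) := by
  unfold delta
  rw [one_mul]
  have hmem : ((K, 1) : ℕ × ℕ) ∈ antidiagonal (K + 1) := mem_antidiagonal.mpr rfl
  have hterm : tailInj σ (K + 1) K * ρ ^ 1 = ρ * σ K := by
    unfold tailInj
    rw [Nat.Ico_succ_singleton, Finset.sum_singleton, pow_one, mul_comm]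
  calc ρ * σ K = tailInj σ (K + 1) ((K, 1) : ℕ × ℕ).1 * ρ ^ ((K, 1) : ℕ × ℕ).2 := hterm.symm
    _ ≤ ∑ p ∈ antidiagonal (K + 1), tailInj σ (K + 1) p.1 * ρ ^ p.2 :=
        Finset.single_le_sum (f := fun p : ℕ × ℕ => tailInj σ (K + 1) p.1 * ρ ^ p.2)
          (fun p _ => mul_nonneg (Finset.sum_nonneg fun i _ => hσ i) (pow_nonneg hρ _)) hmem

/-- **THE THRESHOLD IS EXACT.**  For `σ ≥ 0` NOT summable and `0 < ρ`, the transported totals of the equality-case injection `tailInj σ` are NOT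
summable.  With §2 (`summable_delta_of_tailDominated`): on sign-coherent shifts «`Summable δ^{marg}`» ⟺ «`Σ σ < ∞`»; the tree's geometric
`InjectedRate` is one admissible profile among all ℓ¹ ones (e.g. `σ_i = (i+1)^{−3∕2}` passes here and fits no `C(K+1)^cθ^j`). [folklore] -/
theorem not_summable_delta_tailInj {σ : ℕ → ℝ} (hσ : ∀ i, 0 ≤ σ i) {ρ : ℝ} (hρ : 0 < ρ) (hns : ¬ Summable σ) :
    ¬ Summable (delta 1 ρ (tailInj σ)) := by
  intro hsum
  have h1 : Summable (fun K => delta 1 ρ (tailInj σ) (K + 1)) := (summable_nat_add_iff 1).mpr hsum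
  have h2 : Summable (fun K => ρ * σ K) :=
    Summable.of_nonneg_of_le (fun K => mul_nonneg hρ.le (hσ K)) (fun K => le_delta_tailInj hσ hρ.le K) h1
  exact hns ((summable_mul_left_iff hρ.ne').mp h2)

/-- The lens-2 sketch's `ThresholdExactStatement`, VERBATIM, now a theorem. [folklore] -/
theorem thresholdExact : ∀ (σ : ℕ → ℝ) (ρ : ℝ), (∀ i, 0 ≤ σ i) → 0 < ρ → ρ < 1 → ¬ Summable σ →
    ¬ Summable (delta 1 ρ (fun K j => ∑ i ∈ Ico j K, σ i)) := fun _ _ hσ hρ _ hns => not_summable_delta_tailInj hσ hρ hns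

end Summit.QuantumFields.BalabanUV.T4Continuum.NE7MarginalL1Currency

end
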